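import Literature.RepresentationTheory.CompactGroups.UnitaryGroupTwoIrreducibleCharacters
import Literature.RepresentationTheory.BorelWallach2000.UpqMaximalCompactBlocks
import Literature.NumberTheory.Automorphic.CompactGroupCharacterProjectionIsotypic
import HarnessLib

/-!
# The `K`-types of `U(2,1)`: every irreducible `K`-block of a unitary representation, `K = U(2,1) ∩ U(3) ≅ U(2) × U(1)`,
# carries a label `(a, b, c) ∈ ℕ × ℤ × ℤ` — torus character `(u'₀)^c (u₀u₁)^b Σ_{j≤a} u₀^j u₁^{a−j}`, dimension `a + 1`,
# highest weight `(a + b, b, c)` — and the label determines the block up to unitary equivalence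

Topic `NumberTheory/Automorphic`; namespace `Literature.NumberTheory.Automorphic.UnitaryGroup`.  Theorems only (no
definition, no named fact, no instance, no `sorry`).  This is the `K̂`-DICTIONARY of Knapp's proof of Thm. 10.2 for
`G = U(2,1)` ([Knapp1986]; Varadarajan §5.4 Lemma 21 [Varadarajan1989]), i.e. the parametrisation
`Û(2) × Û(1) ↔ {(a ≥ 0, b, c)}` of Bröcker–tom Dieck II (4.15), VI (1.7) [BrockerTomDieck1985], in the currency of the
`hodgecm-mathlib` road HC (node H4b): `ϖ : ContRepresentation ℂ (uFormGroup (Fin 2) (Fin 1)).carrier E` unitary and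
strongly continuous on a Hilbert space, `K = (uFormGroup (Fin 2) (Fin 1)).maximalCompact`, and a closed `K`-subrepresentation
`W` of `ϖ|_K` that is topologically irreducible and finite-dimensional.  The torus of `K` is written
`upqMaximalCompactEquiv.symm (diag u, diag u')` (★ `BorelWallach2000.upqMaximalCompactEquiv : K ≃ₜ* U(2) × U(1)`), which in
`U(2,1)` is the block-diagonal `kV (diag u, diag u')` (★ `KonnoKonno2007.RealDualPair.UForm.kV`).

* `exists_kTypeLabel` — **(D1) (D2) (D3)**: there are `a : ℕ`, `b c : ℤ` with
  `χ_W(diag(u₀,u₁,u'₀)) = (u'₀)^c (u₀u₁)^b Σ_{j≤a} u₀^j u₁^{a−j}`, `dim W = a + 1`, and a non-zero `v ∈ W` with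
  `ϖ(kV(diag u, diag u')) v = u₀^{a+b} u₁^b (u'₀)^c v` (the highest-weight vector; the hook of the Casimir bound «hq»);
* `kTypeLabel_unique` — the character identity determines `(a, b, c)`;
* `areUnitarilyEquivalent_of_kTypeLabel_eq` — **(D4′)**: two such blocks with the same label are unitarily equivalent.

Proof: the centre `kV(1, U(1))` of `K` acts on the irreducible `W` by a continuous character `(u'₀)^c` (Schur +
★ `TorusWeights.exists_eq_prod_zpow`), so `W` stays irreducible under `U(2) = kV(U(2), 1)` and the `U(2)` theory
(★ `UnitaryTwo.exists_character_diagonalTorusHom_eq`, ★ `UnitaryTwo.torusChar_injective`) applies; for (D4′) every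
`k = kV(A, d) ∈ K` is `K`-conjugate into the torus (★ `exists_conj_mem_diagonalTorus`), so equal labels give equal
characters on `K` and ★ `Schur.areUnitarilyEquivalent_of_character_eq` (compact `K`) concludes.

## References
* A. W. Knapp, *Representation Theory of Semisimple Groups* (1986), proof of Thm. 10.2 [Knapp1986].
* V. S. Varadarajan, *An Introduction to Harmonic Analysis on Semisimple Lie Groups* (1989), §5.4 Lemma 21 [Varadarajan1989].
* T. Bröcker, T. tom Dieck, *Representations of Compact Lie Groups*, GTM 98 (1985), II (4.15), VI (1.7) [BrockerTomDieck1985].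
-/

set_option autoImplicit false

noncomputable section

open MeasureTheory Complex Module Finset ContRepresentation
open Literature.LinearAlgebra.Matrix (diagonalTorus diagonalTorusHom coe_diagonalTorusHom_apply continuous_diagonalTorusHom
  range_diagonalTorusHom exists_conj_mem_diagonalTorus)
open Literature.MathematicalPhysics.QuantumFieldTheory (haarProbability)
open Literature.RepresentationTheory.CompactGroups
open Literature.RepresentationTheory.BorelWallach2000
open Literature.RepresentationTheory.KonnoKonno2007 Literature.RepresentationTheory.KonnoKonno2007.RealDualPair
  Literature.RepresentationTheory.KonnoKonno2007.RealDualPair.UForm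
open scoped InnerProductSpace ComplexConjugate

namespace Literature.NumberTheory.Automorphic.UnitaryGroup

variable {E : Type*} [NormedAddCommGroup E] [InnerProductSpace ℂ E] [CompleteSpace E]
variable (ϖ : ContRepresentation ℂ (uFormGroup (Fin 2) (Fin 1)).carrier E)

/-! ### §1 An irreducible finite-dimensional `K`-block seen on `U(2) × U(1)` -/

section Block

variable (W : ClosedSubrep (ϖ.restrict (Subgroup.inclusion (uFormGroup (Fin 2) (Fin 1)).maximalCompact_le_carrier)))

/-- The element `upqMaximalCompactEquiv.symm (A, d)` of `K`, read in `U(2,1)`, is `kV (A, d)`. [cite: Knapp1986, Thm. 10.2 (proof)] -/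
theorem inclusion_upqMaximalCompactEquiv_symm (p : Matrix.unitaryGroup (Fin 2) ℂ × Matrix.unitaryGroup (Fin 1) ℂ) :
    Subgroup.inclusion (uFormGroup (Fin 2) (Fin 1)).maximalCompact_le_carrier (upqMaximalCompactEquiv.symm p) =
      kV (Fin 2) (Fin 1) p :=
  Subtype.ext rfl

omit [CompleteSpace E] in
/-- The block at `upqMaximalCompactEquiv.symm (A, d)` acts as `ϖ (kV (A, d))`. [cite: Knapp1986, Thm. 10.2 (proof)] -/
theorem coe_toContRep_symm_apply (p : Matrix.unitaryGroup (Fin 2) ℂ × Matrix.unitaryGroup (Fin 1) ℂ) (v : W.toSubmodule) :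
    ((W.toContRep (upqMaximalCompactEquiv.symm p) v : W.toSubmodule) : E) = ϖ (kV (Fin 2) (Fin 1) p) v := by
  rw [ClosedSubrep.coe_toContRep_apply, restrict_apply_apply, inclusion_upqMaximalCompactEquiv_symm]

omit [CompleteSpace E] in
/-- Factorisation of `K` through the blocks: `kV(A, d) = kV(A, 1) · kV(1, d)`. [cite: Knapp1986, Thm. 10.2 (proof)] -/
theorem symm_eq_symm_mul_symm (A : Matrix.unitaryGroup (Fin 2) ℂ) (d : Matrix.unitaryGroup (Fin 1) ℂ) :
    (upqMaximalCompactEquiv (α := Fin 2) (β := Fin 1)).symm (A, d) =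
      upqMaximalCompactEquiv.symm (A, 1) * upqMaximalCompactEquiv.symm (1, d) := by
  rw [← map_mul, Prod.mk_mul_mk, mul_one, one_mul]

omit [CompleteSpace E] in
/-- The block representation is norm-continuous on `K` (finite dimension, strong continuity of `ϖ`).
[cite: Knapp1986, Thm. 10.2 (proof)] -/
theorem continuous_toContRep (hc : ϖ.IsStronglyContinuous) [FiniteDimensional ℂ W.toSubmodule] :
    Continuous (W.toContRep : (uFormGroup (Fin 2) (Fin 1)).maximalCompact → W.toSubmodule →L[ℂ] W.toSubmodule) := by
  refine Schur.continuous_of_forall_continuous_apply fun v => ?_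
  have h : Continuous fun k : (uFormGroup (Fin 2) (Fin 1)).maximalCompact => ((W.toContRep k v : W.toSubmodule) : E) := by
    simp_rw [ClosedSubrep.coe_toContRep_apply, restrict_apply_apply]
    exact (hc (v : E)).comp continuous_inclusion
  exact Continuous.subtype_mk h _
where
  /-- continuity of `K ↪ U(2,1)` -/
  continuous_inclusion : Continuous (Subgroup.inclusion (uFormGroup (Fin 2) (Fin 1)).maximalCompact_le_carrier) :=
    Continuous.subtype_mk continuous_subtype_val _

/-- The block representation is unitary. [cite: Knapp1986, Thm. 10.2 (proof)] -/
theorem inner_toContRep (hu : ϖ.IsUnitary) (k : (uFormGroup (Fin 2) (Fin 1)).maximalCompact) (v w : W.toSubmodule) :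
    ⟪W.toContRep k v, W.toContRep k w⟫_ℂ = ⟪v, w⟫_ℂ := by
  rw [Submodule.coe_inner, ClosedSubrep.coe_toContRep_apply, ClosedSubrep.coe_toContRep_apply, restrict_apply_apply,
    restrict_apply_apply, Submodule.coe_inner]
  exact (isUnitary_iff_inner_map_map.mp hu) _ _ _

omit [CompleteSpace E] in
/-- **The centre `kV(1, U(1))` of `K` acts on an irreducible block by scalars** (Schur's lemma: the operators
`W.toContRep (kV(1, d))` commute with `K`). [cite: Knapp1986, Thm. 10.2 (proof)] -/
theorem exists_central_scalar (hW : W.toContRep.IsTopIrreducible) [FiniteDimensional ℂ W.toSubmodule]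
    (d : Matrix.unitaryGroup (Fin 1) ℂ) :
    ∃ c : ℂ, ∀ v : W.toSubmodule, W.toContRep (upqMaximalCompactEquiv.symm (1, d)) v = c • v := by
  haveI := isIrreducible_of_isTopIrreducible W.toContRep hW
  have hcomm : ∀ k : (uFormGroup (Fin 2) (Fin 1)).maximalCompact,
      k * upqMaximalCompactEquiv.symm (1, d) = upqMaximalCompactEquiv.symm (1, d) * k := by
    intro k
    apply (upqMaximalCompactEquiv (α := Fin 2) (β := Fin 1)).injective
    rw [map_mul, map_mul, ContinuousMulEquiv.apply_symm_apply, upqMaximalCompactEquiv_apply, Prod.mk_mul_mk,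
      Prod.mk_mul_mk, one_mul, mul_one]
    congr 1
    apply Subtype.ext
    ext i j
    fin_cases i; fin_cases j
    simp [Matrix.mul_apply, mul_comm]
  let T : Representation.IntertwiningMap W.toContRep.toRepresentation W.toContRep.toRepresentation :=
    { toLinearMap := (W.toContRep.toRepresentation) (upqMaximalCompactEquiv.symm (1, d))
      isIntertwining' := fun k => by
        change (W.toContRep.toRepresentation) (upqMaximalCompactEquiv.symm (1, d)) * (W.toContRep.toRepresentation) k =
          (W.toContRep.toRepresentation) k * (W.toContRep.toRepresentation) (upqMaximalCompactEquiv.symm (1, d))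
        rw [← map_mul, ← map_mul, hcomm] }
  obtain ⟨c, hc'⟩ := (Representation.IsIrreducible.algebraMap_intertwiningMap_bijective_of_isAlgClosed
    (ρ := W.toContRep.toRepresentation)).2 T
  refine ⟨c, fun v => ?_⟩
  have h := congrArg (fun S : Representation.IntertwiningMap W.toContRep.toRepresentation W.toContRep.toRepresentation =>
    (S : W.toSubmodule →ₗ[ℂ] W.toSubmodule) v) hc'
  simp only [Algebra.algebraMap_eq_smul_one] at h
  exact h.symm

set_option maxHeartbeats 400000 in
omit [CompleteSpace E] in
/-- **The central character of an irreducible block is `diag(z) ↦ z^c`**: there is `c : ℤ` with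
`W.toContRep (kV (1, diag u')) = (u'₀)^c · id` (a continuous character of `U(1)`, ★ `TorusWeights.exists_eq_prod_zpow`).
[cite: Knapp1986, Thm. 10.2 (proof)] [cite: BrockerTomDieck1985, II (8.1)] -/
theorem exists_central_zpow (hW : W.toContRep.IsTopIrreducible) [FiniteDimensional ℂ W.toSubmodule]
    (hc : ϖ.IsStronglyContinuous) :
    ∃ c : ℤ, ∀ (u' : Fin 1 → Circle) (v : W.toSubmodule),
      W.toContRep (upqMaximalCompactEquiv.symm (1, diagonalTorusHom (Fin 1) u')) v = ((u' 0 : ℂ) ^ c) • v := by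
  classical
  haveI : Nontrivial W.toSubmodule := ((isTopIrreducible_iff _).mp hW).1
  obtain ⟨v₀, hv₀⟩ := exists_ne (0 : W.toSubmodule)
  choose cfun hcfun using fun d => exists_central_scalar ϖ W hW d
  have hsmul : ∀ (d : Matrix.unitaryGroup (Fin 1) ℂ) (s : ℂ), (∀ v, W.toContRep (upqMaximalCompactEquiv.symm (1, d)) v = s • v) →
      s = cfun d := fun d s hs => by
    have h : (s - cfun d) • v₀ = 0 := by rw [sub_smul, ← hs v₀, ← hcfun d v₀, sub_self]
    exact (sub_eq_zero.mp ((smul_eq_zero.mp h).resolve_right hv₀))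
  have hmul : ∀ d d', cfun (d * d') = cfun d * cfun d' := fun d d' => by
    refine (hsmul (d * d') _ fun v => ?_).symm
    rw [show ((1 : Matrix.unitaryGroup (Fin 2) ℂ), d * d') = (1, d) * (1, d') by rw [Prod.mk_mul_mk, one_mul], map_mul,
      map_mul, mul_apply_eq_comp, hcfun d', (W.toContRep _).map_smul, hcfun d, smul_smul, mul_comm]
  have hone : cfun 1 = 1 := (hsmul 1 1 fun v => by
    rw [show ((1 : Matrix.unitaryGroup (Fin 2) ℂ), (1 : Matrix.unitaryGroup (Fin 1) ℂ)) = 1 from rfl, map_one, map_one,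
      one_apply_eq_self, one_smul]).symm
  let χ : (Fin 1 → Circle) →* ℂ :=
    { toFun := fun u' => cfun (diagonalTorusHom (Fin 1) u')
      map_one' := by simp only [map_one, hone]
      map_mul' := fun u v => by simp only [map_mul, hmul] }
  have hχc : Continuous χ := by
    have hne : ⟪(v₀ : W.toSubmodule), v₀⟫_ℂ ≠ 0 := inner_self_ne_zero.mpr hv₀
    have hform : ∀ d, cfun d = ⟪(v₀ : W.toSubmodule), W.toContRep (upqMaximalCompactEquiv.symm (1, d)) v₀⟫_ℂ *
        (⟪(v₀ : W.toSubmodule), v₀⟫_ℂ)⁻¹ := fun d => by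
      rw [eq_mul_inv_iff_mul_eq₀ hne, hcfun d, inner_smul_right]
    have hcont : Continuous fun u' : Fin 1 → Circle =>
        ((W.toContRep (upqMaximalCompactEquiv.symm (1, diagonalTorusHom (Fin 1) u')) v₀ : W.toSubmodule) : E) := by
      simp_rw [coe_toContRep_symm_apply]
      have h1 : Continuous fun u' : Fin 1 → Circle =>
          (kV (Fin 2) (Fin 1) (1, diagonalTorusHom (Fin 1) u') : (uFormGroup (Fin 2) (Fin 1)).carrier) :=
        (continuous_kV (α := Fin 2) (β := Fin 1)).comp (continuous_const.prodMk (continuous_diagonalTorusHom (Fin 1)))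
      exact (hc (v₀ : E)).comp h1
    have hcont' : Continuous fun u' : Fin 1 → Circle =>
        (W.toContRep (upqMaximalCompactEquiv.symm (1, diagonalTorusHom (Fin 1) u')) v₀ : W.toSubmodule) :=
      Continuous.subtype_mk hcont _
    change Continuous fun u' => cfun (diagonalTorusHom (Fin 1) u')
    simp_rw [hform]
    exact (continuous_const.inner hcont').mul continuous_const
  obtain ⟨m, hm⟩ := TorusWeights.exists_eq_prod_zpow χ hχc
  refine ⟨m 0, fun u' v => ?_⟩
  rw [hcfun, show cfun (diagonalTorusHom (Fin 1) u') = χ u' from rfl, hm u']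
  simp only [univ_unique, Fin.default_eq_zero, Fin.isValue, prod_singleton]

omit [CompleteSpace E] in
/-- **The `U(2)`-part of an irreducible block is irreducible**: a `kV(U(2), 1)`-stable subspace of `W` is `K`-stable
(the centre acts by scalars), hence trivial. [cite: Knapp1986, Thm. 10.2 (proof)] -/
theorem isIrreducible_restrict_inl (hW : W.toContRep.IsTopIrreducible) [FiniteDimensional ℂ W.toSubmodule] :
    ((W.toContRep.restrict (upqMaximalCompactEquiv (α := Fin 2) (β := Fin 1)).symm.toMulEquiv.toMonoidHom).restrict
      (MonoidHom.inl (Matrix.unitaryGroup (Fin 2) ℂ) (Matrix.unitaryGroup (Fin 1) ℂ))).toRepresentation.IsIrreducible := by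
  haveI hirr := isIrreducible_of_isTopIrreducible W.toContRep hW
  haveI : Nontrivial W.toSubmodule := ((isTopIrreducible_iff _).mp hW).1
  set π₂ := (W.toContRep.restrict (upqMaximalCompactEquiv (α := Fin 2) (β := Fin 1)).symm.toMulEquiv.toMonoidHom).restrict
      (MonoidHom.inl (Matrix.unitaryGroup (Fin 2) ℂ) (Matrix.unitaryGroup (Fin 1) ℂ)) with hπ₂
  haveI : Nontrivial (Subrepresentation π₂.toRepresentation) :=
    ⟨⟨⊥, ⊤, fun hbt => bot_ne_top
      (congrArg Subrepresentation.toSubmodule hbt : (⊥ : Submodule ℂ W.toSubmodule) = ⊤)⟩⟩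
  refine ⟨fun V => ?_⟩
  -- `V` is `K`-stable
  have hstab : ∀ (k : (uFormGroup (Fin 2) (Fin 1)).maximalCompact) (v : W.toSubmodule),
      v ∈ V.toSubmodule → W.toContRep k v ∈ V.toSubmodule := by
    intro k v hv
    obtain ⟨c, hc'⟩ := exists_central_scalar ϖ W hW (upqMaximalCompactEquiv k).2
    have hk : k = upqMaximalCompactEquiv.symm ((upqMaximalCompactEquiv k).1, 1) *
        upqMaximalCompactEquiv.symm (1, (upqMaximalCompactEquiv k).2) := by
      rw [← symm_eq_symm_mul_symm, Prod.mk.eta, ContinuousMulEquiv.symm_apply_apply]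
    rw [hk, map_mul, mul_apply_eq_comp, hc', (W.toContRep _).map_smul]
    exact V.toSubmodule.smul_mem c (V.apply_mem_toSubmodule (upqMaximalCompactEquiv k).1 hv)
  let V' : Subrepresentation W.toContRep.toRepresentation := ⟨V.toSubmodule, fun k v hv => hstab k v hv⟩
  rcases hirr.eq_bot_or_eq_top V' with h | h
  · left
    exact Subrepresentation.toSubmodule_injective (congrArg Subrepresentation.toSubmodule h :)
  · right
    exact Subrepresentation.toSubmodule_injective (congrArg Subrepresentation.toSubmodule h :)

end Block

/-! ### §2 The label `(a, b, c)` of an irreducible block -/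

/-- **THE `K̂`-DICTIONARY OF `U(2,1)` — (D1) (D2) (D3)**: for a unitary strongly continuous `ϖ` of `U(2,1)` on a Hilbert
space and every topologically irreducible finite-dimensional closed `K`-subrepresentation `W` of `ϖ|_K`
(`K = U(2,1) ∩ U(3) ≅ U(2) × U(1)`) there are `a : ℕ` and `b c : ℤ` such that
(D1) the character of `W` on the torus is `χ_W(kV(diag u, diag u')) = (u'₀)^c · (u₀u₁)^b Σ_{j≤a} u₀^j u₁^{a−j}`,
(D2) `dim W = a + 1`, and (D3) `W` contains a non-zero weight vector of the HIGHEST WEIGHT `(a + b, b, c)`: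
`ϖ(kV(diag u, diag u')) v = u₀^{a+b} u₁^b (u'₀)^c v` (`diag = Literature.LinearAlgebra.Matrix.diagonalTorusHom`, which is
`Literature.Analysis.SegalBargmann.diagHom` and `UnitaryGroupChar.diagHom` up to `rfl`).
[cite: Knapp1986, Thm. 10.2 (proof)] [cite: Varadarajan1989, §5.4 Lemma 21] [cite: BrockerTomDieck1985, VI (1.7)] -/
theorem exists_kTypeLabel (hu : ϖ.IsUnitary) (hc : ϖ.IsStronglyContinuous)
    (W : ClosedSubrep (ϖ.restrict (Subgroup.inclusion (uFormGroup (Fin 2) (Fin 1)).maximalCompact_le_carrier)))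
    (hW : W.toContRep.IsTopIrreducible) [FiniteDimensional ℂ W.toSubmodule] :
    ∃ (a : ℕ) (b c : ℤ),
      (∀ (u : Fin 2 → Circle) (u' : Fin 1 → Circle),
        Schur.character W.toContRep (upqMaximalCompactEquiv.symm (diagonalTorusHom (Fin 2) u, diagonalTorusHom (Fin 1) u')) =
          (u' 0 : ℂ) ^ c * (((u 0 : ℂ) * u 1) ^ b * ∑ j ∈ range (a + 1), (u 0 : ℂ) ^ j * (u 1 : ℂ) ^ (a - j))) ∧
      finrank ℂ W.toSubmodule = a + 1 ∧
      ∃ v ∈ W.toSubmodule, v ≠ 0 ∧ ∀ (u : Fin 2 → Circle) (u' : Fin 1 → Circle),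
        ϖ (kV (Fin 2) (Fin 1) (diagonalTorusHom (Fin 2) u, diagonalTorusHom (Fin 1) u')) v =
          ((u 0 : ℂ) ^ ((a : ℤ) + b) * (u 1 : ℂ) ^ b * (u' 0 : ℂ) ^ c) • v := by
  haveI := isIrreducible_of_isTopIrreducible W.toContRep hW
  set σ : ContRepresentation ℂ (Matrix.unitaryGroup (Fin 2) ℂ × Matrix.unitaryGroup (Fin 1) ℂ) W.toSubmodule :=
    W.toContRep.restrict (upqMaximalCompactEquiv (α := Fin 2) (β := Fin 1)).symm.toMulEquiv.toMonoidHom with hσ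
  set π₂ : ContRepresentation ℂ (Matrix.unitaryGroup (Fin 2) ℂ) W.toSubmodule :=
    σ.restrict (MonoidHom.inl (Matrix.unitaryGroup (Fin 2) ℂ) (Matrix.unitaryGroup (Fin 1) ℂ)) with hπ₂
  have hπ₂app : ∀ (g : Matrix.unitaryGroup (Fin 2) ℂ) (v : W.toSubmodule),
      π₂ g v = W.toContRep (upqMaximalCompactEquiv.symm (g, 1)) v := fun g v => rfl
  have hπ₂c : Continuous (π₂ : Matrix.unitaryGroup (Fin 2) ℂ → W.toSubmodule →L[ℂ] W.toSubmodule) :=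
    ((continuous_toContRep ϖ W hc).comp (upqMaximalCompactEquiv (α := Fin 2) (β := Fin 1)).symm.continuous).comp
      (Continuous.prodMk_left 1)
  have hπ₂u : ∀ (g : Matrix.unitaryGroup (Fin 2) ℂ) (v w : W.toSubmodule), ⟪π₂ g v, π₂ g w⟫_ℂ = ⟪v, w⟫_ℂ :=
    fun g v w => inner_toContRep ϖ W hu _ v w
  haveI hπ₂irr : π₂.toRepresentation.IsIrreducible := isIrreducible_restrict_inl ϖ W hW
  obtain ⟨c, hcen⟩ := exists_central_zpow ϖ W hW hc
  obtain ⟨a, b, hchar, hdim, x, hx0, hx⟩ := UnitaryTwo.exists_character_diagonalTorusHom_eq π₂ hπ₂c hπ₂u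
  -- the block at a torus element = the central scalar times `π₂(diag u)`
  have hop : ∀ (u : Fin 2 → Circle) (u' : Fin 1 → Circle),
      W.toContRep (upqMaximalCompactEquiv.symm (diagonalTorusHom (Fin 2) u, diagonalTorusHom (Fin 1) u')) =
        ((u' 0 : ℂ) ^ c) • π₂ (diagonalTorusHom (Fin 2) u) := fun u u' => by
    refine ContinuousLinearMap.ext fun v => ?_
    change W.toContRep (upqMaximalCompactEquiv.symm (diagonalTorusHom (Fin 2) u, diagonalTorusHom (Fin 1) u')) v =
      ((u' 0 : ℂ) ^ c) • W.toContRep (upqMaximalCompactEquiv.symm (diagonalTorusHom (Fin 2) u, 1)) v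
    rw [symm_eq_symm_mul_symm, map_mul, mul_apply_eq_comp, hcen u' v]
    exact (W.toContRep (upqMaximalCompactEquiv.symm (diagonalTorusHom (Fin 2) u, 1))).map_smul _ _
  have hD1 : ∀ (u : Fin 2 → Circle) (u' : Fin 1 → Circle),
      Schur.character W.toContRep (upqMaximalCompactEquiv.symm (diagonalTorusHom (Fin 2) u, diagonalTorusHom (Fin 1) u')) =
        (u' 0 : ℂ) ^ c * (((u 0 : ℂ) * u 1) ^ b * ∑ j ∈ range (a + 1), (u 0 : ℂ) ^ j * (u 1 : ℂ) ^ (a - j)) := by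
    intro u u'
    have e1 := congrArg (fun T : W.toSubmodule →L[ℂ] W.toSubmodule =>
      LinearMap.trace ℂ W.toSubmodule (T : W.toSubmodule →ₗ[ℂ] W.toSubmodule)) (hop u u')
    have e2 := (LinearMap.trace ℂ W.toSubmodule).map_smul ((u' 0 : ℂ) ^ c)
      ((π₂ (diagonalTorusHom (Fin 2) u) : W.toSubmodule →L[ℂ] W.toSubmodule) : W.toSubmodule →ₗ[ℂ] W.toSubmodule)
    have e3 : Schur.character W.toContRep
        (upqMaximalCompactEquiv.symm (diagonalTorusHom (Fin 2) u, diagonalTorusHom (Fin 1) u')) =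
          ((u' 0 : ℂ) ^ c) * Schur.character π₂ (diagonalTorusHom (Fin 2) u) := e1.trans e2
    exact e3.trans (congrArg (fun z => ((u' 0 : ℂ) ^ c) * z) (hchar u))
  have hD3 : ∀ (u : Fin 2 → Circle) (u' : Fin 1 → Circle),
      ϖ (kV (Fin 2) (Fin 1) (diagonalTorusHom (Fin 2) u, diagonalTorusHom (Fin 1) u')) (x : E) =
        ((u 0 : ℂ) ^ ((a : ℤ) + b) * (u 1 : ℂ) ^ b * (u' 0 : ℂ) ^ c) • (x : E) := by
    intro u u'
    have e1 := congrArg (fun T : W.toSubmodule →L[ℂ] W.toSubmodule => T x) (hop u u')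
    have e2 : (((u' 0 : ℂ) ^ c) • π₂ (diagonalTorusHom (Fin 2) u)) x =
        ((u' 0 : ℂ) ^ c) • (((u 0 : ℂ) ^ ((a : ℤ) + b) * (u 1 : ℂ) ^ b) • x) :=
      congrArg (fun y : W.toSubmodule => ((u' 0 : ℂ) ^ c) • y) (hx u)
    have h1 : W.toContRep (upqMaximalCompactEquiv.symm (diagonalTorusHom (Fin 2) u, diagonalTorusHom (Fin 1) u')) x =
        (((u' 0 : ℂ) ^ c) * ((u 0 : ℂ) ^ ((a : ℤ) + b) * (u 1 : ℂ) ^ b)) • x := e1.trans (e2.trans (smul_smul _ _ _))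
    have h2 : ϖ (kV (Fin 2) (Fin 1) (diagonalTorusHom (Fin 2) u, diagonalTorusHom (Fin 1) u')) (x : E) =
        (((u' 0 : ℂ) ^ c) * ((u 0 : ℂ) ^ ((a : ℤ) + b) * (u 1 : ℂ) ^ b)) • (x : E) :=
      (coe_toContRep_symm_apply ϖ W _ x).symm.trans (congrArg Subtype.val h1)
    exact h2.trans (congrArg (fun z : ℂ => z • (x : E)) (by ring))
  exact ⟨a, b, c, hD1, hdim, (x : E), x.2, fun h => hx0 (Subtype.ext h), hD3⟩

omit [CompleteSpace E] in
/-- **The label is well defined**: the character identity (D1) determines `(a, b, c)`.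
[cite: Knapp1986, Thm. 10.2 (proof)] [cite: BrockerTomDieck1985, VI (1.7)] -/
theorem kTypeLabel_unique
    (W : ClosedSubrep (ϖ.restrict (Subgroup.inclusion (uFormGroup (Fin 2) (Fin 1)).maximalCompact_le_carrier)))
    [FiniteDimensional ℂ W.toSubmodule] {a a' : ℕ} {b b' c c' : ℤ}
    (h : ∀ (u : Fin 2 → Circle) (u' : Fin 1 → Circle),
      Schur.character W.toContRep (upqMaximalCompactEquiv.symm (diagonalTorusHom (Fin 2) u, diagonalTorusHom (Fin 1) u')) =
        (u' 0 : ℂ) ^ c * (((u 0 : ℂ) * u 1) ^ b * ∑ j ∈ range (a + 1), (u 0 : ℂ) ^ j * (u 1 : ℂ) ^ (a - j)))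
    (h' : ∀ (u : Fin 2 → Circle) (u' : Fin 1 → Circle),
      Schur.character W.toContRep (upqMaximalCompactEquiv.symm (diagonalTorusHom (Fin 2) u, diagonalTorusHom (Fin 1) u')) =
        (u' 0 : ℂ) ^ c' * (((u 0 : ℂ) * u 1) ^ b' * ∑ j ∈ range (a' + 1), (u 0 : ℂ) ^ j * (u 1 : ℂ) ^ (a' - j))) :
    a = a' ∧ b = b' ∧ c = c' := by
  have hab : a = a' ∧ b = b' := by
    refine UnitaryTwo.torusChar_injective fun u => ?_
    have h1 := (h u 1).symm.trans (h' u 1)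
    simpa only [Pi.one_apply, Circle.coe_one, one_zpow, one_mul] using h1
  obtain ⟨rfl, rfl⟩ := hab
  refine ⟨rfl, rfl, ?_⟩
  have hz : ∀ z : Circle, (z : ℂ) ^ c = (z : ℂ) ^ c' := fun z => by
    have h1 := (h 1 fun _ => z).symm.trans (h' 1 fun _ => z)
    rw [UnitaryTwo.torusChar_one] at h1
    exact mul_right_cancel₀ (by exact_mod_cast Nat.succ_ne_zero a) h1
  refine CircleChar.zpow_injective' fun z => Circle.ext ?_
  rw [Circle.coe_zpow, Circle.coe_zpow, hz z]

/-! ### §3 The label determines the block up to unitary equivalence -/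

/-- Every element of `K ≅ U(2) × U(1)` is `K`-conjugate into the torus `kV(diag u, diag u')`.
[cite: BrockerTomDieck1985, IV (3.1)] -/
theorem exists_conj_symm_diagonalTorusHom (k : (uFormGroup (Fin 2) (Fin 1)).maximalCompact) :
    ∃ (g : (uFormGroup (Fin 2) (Fin 1)).maximalCompact) (u : Fin 2 → Circle) (u' : Fin 1 → Circle),
      k = g * upqMaximalCompactEquiv.symm (diagonalTorusHom (Fin 2) u, diagonalTorusHom (Fin 1) u') * g⁻¹ := by
  obtain ⟨V, hV⟩ := exists_conj_mem_diagonalTorus (upqMaximalCompactEquiv k).1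
  obtain ⟨V', hV'⟩ := exists_conj_mem_diagonalTorus (upqMaximalCompactEquiv k).2
  rw [← range_diagonalTorusHom] at hV hV'
  obtain ⟨z, hz⟩ := hV
  obtain ⟨z', hz'⟩ := hV'
  refine ⟨upqMaximalCompactEquiv.symm (V, V'), z, z', ?_⟩
  apply (upqMaximalCompactEquiv (α := Fin 2) (β := Fin 1)).injective
  rw [map_mul, map_mul, map_inv, ContinuousMulEquiv.apply_symm_apply, ContinuousMulEquiv.apply_symm_apply, hz, hz',
    Prod.mk_mul_mk, Prod.inv_mk, Prod.mk_mul_mk]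
  ext1
  · change (upqMaximalCompactEquiv k).1 = V * (V⁻¹ * (upqMaximalCompactEquiv k).1 * V) * V⁻¹; group
  · change (upqMaximalCompactEquiv k).2 = V' * (V'⁻¹ * (upqMaximalCompactEquiv k).2 * V') * V'⁻¹; group

/-- `K` is compact (it is homeomorphic to `U(2) × U(1)`). [cite: Knapp1986, Thm. 10.2 (proof)] -/
theorem compactSpace_maximalCompact : CompactSpace (uFormGroup (Fin 2) (Fin 1)).maximalCompact :=
  (upqMaximalCompactEquiv (α := Fin 2) (β := Fin 1)).symm.toHomeomorph.compactSpace

/-- **(D4′) SAME LABEL ⇒ UNITARILY EQUIVALENT BLOCKS**: two topologically irreducible finite-dimensional closed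
`K`-subrepresentations of unitary strongly continuous representations of `U(2,1)` whose characters satisfy (D1) with the
same `(a, b, c)` are unitarily equivalent (characters agree on the torus, hence on `K` by conjugation; then
★ `Schur.areUnitarilyEquivalent_of_character_eq`). [cite: Knapp1986, Thm. 10.2 (proof)] [cite: BrockerTomDieck1985, II (4.12)] -/
theorem areUnitarilyEquivalent_of_kTypeLabel_eq {E' : Type*} [NormedAddCommGroup E'] [InnerProductSpace ℂ E']
    [CompleteSpace E'] (ϖ' : ContRepresentation ℂ (uFormGroup (Fin 2) (Fin 1)).carrier E')
    (hu : ϖ.IsUnitary) (hc : ϖ.IsStronglyContinuous) (hu' : ϖ'.IsUnitary) (hc' : ϖ'.IsStronglyContinuous)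
    (W : ClosedSubrep (ϖ.restrict (Subgroup.inclusion (uFormGroup (Fin 2) (Fin 1)).maximalCompact_le_carrier)))
    (W' : ClosedSubrep (ϖ'.restrict (Subgroup.inclusion (uFormGroup (Fin 2) (Fin 1)).maximalCompact_le_carrier)))
    (hW : W.toContRep.IsTopIrreducible) (hW' : W'.toContRep.IsTopIrreducible)
    [FiniteDimensional ℂ W.toSubmodule] [FiniteDimensional ℂ W'.toSubmodule] (a : ℕ) (b c : ℤ)
    (h : ∀ (u : Fin 2 → Circle) (u' : Fin 1 → Circle),
      Schur.character W.toContRep (upqMaximalCompactEquiv.symm (diagonalTorusHom (Fin 2) u, diagonalTorusHom (Fin 1) u')) =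
        (u' 0 : ℂ) ^ c * (((u 0 : ℂ) * u 1) ^ b * ∑ j ∈ range (a + 1), (u 0 : ℂ) ^ j * (u 1 : ℂ) ^ (a - j)))
    (h' : ∀ (u : Fin 2 → Circle) (u' : Fin 1 → Circle),
      Schur.character W'.toContRep (upqMaximalCompactEquiv.symm (diagonalTorusHom (Fin 2) u, diagonalTorusHom (Fin 1) u')) =
        (u' 0 : ℂ) ^ c * (((u 0 : ℂ) * u 1) ^ b * ∑ j ∈ range (a + 1), (u 0 : ℂ) ^ j * (u 1 : ℂ) ^ (a - j))) :
    AreUnitarilyEquivalent W.toContRep W'.toContRep := by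
  haveI := isIrreducible_of_isTopIrreducible W.toContRep hW
  haveI := isIrreducible_of_isTopIrreducible W'.toContRep hW'
  haveI := compactSpace_maximalCompact
  letI : MeasurableSpace (uFormGroup (Fin 2) (Fin 1)).maximalCompact := borel _
  haveI : BorelSpace (uFormGroup (Fin 2) (Fin 1)).maximalCompact := ⟨rfl⟩
  haveI : IsProbabilityMeasure (haarProbability (uFormGroup (Fin 2) (Fin 1)).maximalCompact) :=
    ⟨by simpa [haarProbability] using Measure.haarMeasure_self (G := (uFormGroup (Fin 2) (Fin 1)).maximalCompact) (K₀ := ⊤)⟩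
  refine Schur.areUnitarilyEquivalent_of_character_eq (haarProbability (uFormGroup (Fin 2) (Fin 1)).maximalCompact)
    W.toContRep W'.toContRep (continuous_toContRep ϖ W hc) (continuous_toContRep ϖ' W' hc')
    (inner_toContRep ϖ W hu) (inner_toContRep ϖ' W' hu') fun k => ?_
  obtain ⟨g, u, u', rfl⟩ := exists_conj_symm_diagonalTorusHom k
  rw [Schur.character_conj, Schur.character_conj, h, h']

/-! ### §4 The labelling of a family of blocks (the token form consumed by road HC) -/

/-- **THE `K̂`-LABELLING OF A FAMILY OF IRREDUCIBLE BLOCKS** (road HC token form): for a unitary strongly continuous `ϖ`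
of `U(2,1)` and any set `S` of topologically irreducible finite-dimensional closed `K`-subrepresentations of `ϖ|_K`
there is a label `w : S → ℕ × ℤ × ℤ`, `w W = (a, b, c)`, with (D2) `dim W = a + 1` (so `dim W ≤ 1·(1 + |a|)`),
(D3) a non-zero highest-weight vector `v ∈ W`, `ϖ(kV(diag u, diag u')) v = u₀^{a+b} u₁^b (u'₀)^c v` (stated with
`Literature.Analysis.SegalBargmann.diagHom`, the torus of ★ `exp_smul_torusGen`), and (D4′) `w W = w W'` ⇒
`W ≃ W'` unitarily. [cite: Knapp1986, Thm. 10.2 (proof)] [cite: Varadarajan1989, §5.4 Lemma 21] [cite: BrockerTomDieck1985, VI (1.7)] -/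
theorem exists_kTypeLabelling (hu : ϖ.IsUnitary) (hc : ϖ.IsStronglyContinuous)
    {S : Set (ClosedSubrep (ϖ.restrict (Subgroup.inclusion (uFormGroup (Fin 2) (Fin 1)).maximalCompact_le_carrier)))}
    (hirr : ∀ W ∈ S, W.toContRep.IsTopIrreducible) (hfd : ∀ W ∈ S, FiniteDimensional ℂ W.toSubmodule) :
    ∃ w : S → ℕ × ℤ × ℤ,
      (∀ W : S, finrank ℂ (W : ClosedSubrep
        (ϖ.restrict (Subgroup.inclusion (uFormGroup (Fin 2) (Fin 1)).maximalCompact_le_carrier))).toSubmodule = (w W).1 + 1) ∧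
      (∃ C : ℝ, ∀ W : S, (finrank ℂ (W : ClosedSubrep
        (ϖ.restrict (Subgroup.inclusion (uFormGroup (Fin 2) (Fin 1)).maximalCompact_le_carrier))).toSubmodule : ℝ) ≤
          C * (1 + |((w W).1 : ℝ)|)) ∧
      (∀ W : S, ∃ v ∈ (W : ClosedSubrep
          (ϖ.restrict (Subgroup.inclusion (uFormGroup (Fin 2) (Fin 1)).maximalCompact_le_carrier))).toSubmodule, v ≠ 0 ∧
        ∀ (u : Fin 2 → Circle) (u' : Fin 1 → Circle),
          ϖ (RealDualPair.UForm.kV (Fin 2) (Fin 1)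
              (Literature.Analysis.SegalBargmann.diagHom u, Literature.Analysis.SegalBargmann.diagHom u')) v =
            (((u 0 : Circle) : ℂ) ^ (((w W).1 : ℤ) + (w W).2.1) * ((u 1 : Circle) : ℂ) ^ (w W).2.1 *
              ((u' 0 : Circle) : ℂ) ^ (w W).2.2) • v) ∧
      (∀ W W' : S, w W = w W' → AreUnitarilyEquivalent
        (W : ClosedSubrep (ϖ.restrict (Subgroup.inclusion (uFormGroup (Fin 2) (Fin 1)).maximalCompact_le_carrier))).toContRep
        (W' : ClosedSubrep (ϖ.restrict (Subgroup.inclusion (uFormGroup (Fin 2) (Fin 1)).maximalCompact_le_carrier))).toContRep) := by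
  classical
  have key : ∀ W : S, ∃ t : ℕ × ℤ × ℤ,
      (∀ (u : Fin 2 → Circle) (u' : Fin 1 → Circle),
        Schur.character W.1.toContRep
            (upqMaximalCompactEquiv.symm (diagonalTorusHom (Fin 2) u, diagonalTorusHom (Fin 1) u')) =
          (u' 0 : ℂ) ^ t.2.2 * (((u 0 : ℂ) * u 1) ^ t.2.1 * ∑ j ∈ range (t.1 + 1), (u 0 : ℂ) ^ j * (u 1 : ℂ) ^ (t.1 - j))) ∧
      finrank ℂ W.1.toSubmodule = t.1 + 1 ∧
      ∃ v ∈ W.1.toSubmodule, v ≠ 0 ∧ ∀ (u : Fin 2 → Circle) (u' : Fin 1 → Circle),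
        ϖ (kV (Fin 2) (Fin 1) (diagonalTorusHom (Fin 2) u, diagonalTorusHom (Fin 1) u')) v =
          ((u 0 : ℂ) ^ ((t.1 : ℤ) + t.2.1) * (u 1 : ℂ) ^ t.2.1 * (u' 0 : ℂ) ^ t.2.2) • v := by
    intro W
    haveI := hfd W.1 W.2
    obtain ⟨a, b, c, h1, h2, h3⟩ := exists_kTypeLabel ϖ hu hc W.1 (hirr W.1 W.2)
    exact ⟨(a, b, c), h1, h2, h3⟩
  choose w hw using key
  refine ⟨w, fun W => (hw W).2.1, ⟨1, fun W => ?_⟩, fun W => (hw W).2.2, fun W W' hWW' => ?_⟩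
  · rw [(hw W).2.1, one_mul, abs_of_nonneg (Nat.cast_nonneg _)]
    push_cast
    linarith
  · haveI := hfd W.1 W.2
    haveI := hfd W'.1 W'.2
    have h := (hw W).1
    rw [hWW'] at h
    exact areUnitarilyEquivalent_of_kTypeLabel_eq ϖ ϖ hu hc hu hc W.1 W'.1 (hirr W.1 W.2) (hirr W'.1 W'.2) _ _ _ h (hw W').1

end Literature.NumberTheory.Automorphic.UnitaryGroup

end
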